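import Mathlib.AlgebraicGeometry.Morphisms.FiniteType
import Literature.AlgebraicGeometry.Motives.SubschemeCyclesDimProofs
import HarnessLib

/-!
# Dimensions of closures of points do not increase under morphisms

Topic: `Literature/AlgebraicGeometry/Motives`. For a `K`-morphism `f : X ⟶ Y` of schemes locally of
finite type over a field `K` and a point `x ∈ X`, the dimension of the closure of the image point is
at most the dimension of the closure of the point:
`dim closure {f x} = Order.height (f x) ≤ Order.height x = dim closure {x}`
(Görtz–Wedhorn I, Thm. 5.22 (1): both are transcendence degrees of residue fields over `K`, and
`κ(f x) ↪ κ(x)`). Companion of `height_eq_height_of_residueFieldMap_surjective`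
(`CyclesBirationalLiftProofs`), same proof with `Algebra.trdeg` monotone under injective `K`-algebra
maps (Mathlib `trdeg_le_of_injective`) in place of invariance under isomorphisms.

## References

* U. Görtz, T. Wedhorn, *Algebraic Geometry I*, 2nd ed. (2020), Thm. 5.22 (1), Lemma 5.7.
-/

noncomputable section

open CategoryTheory AlgebraicGeometry Order

universe u

namespace Literature.AlgebraicGeometry.Motives

section Height

variable {K : Type u} [Field K] {X Y : Scheme.{u}}

/-- **`dim closure {f x} ≤ dim closure {x}`.** For a `K`-morphism `f : X → Y` of schemes locally of
finite type over a field `K` and a point `x`, `Order.height (f x) ≤ Order.height x`: both heights are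
the transcendence degrees over `K` of the residue fields (Görtz–Wedhorn I, Thm. 5.22 (1), the tree's
`Scheme.height_eq_toENat_trdeg_residueField`), and the residue field map `κ(f x) → κ(x)` is an
injective `K`-algebra map, along which the transcendence degree does not decrease (Mathlib
`trdeg_le_of_injective`). [cite: GortzWedhorn2020, Thm. 5.22 (1)] -/
theorem height_base_le_height (f : X ⟶ Y) (p : Y ⟶ Spec (CommRingCat.of K))
    [LocallyOfFiniteType p] [LocallyOfFiniteType (f ≫ p)] (x : X) :
    height (f.base x) ≤ height x := by
  -- the `K`-algebra structures on `κ(f x)` (by evaluation) and on `κ(x)` (through `κ(f x)`)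
  letI algY : Algebra K (Y.residueField (f.base x)) :=
    ((Scheme.ΓSpecIso (CommRingCat.of K)).inv ≫ p.appTop ≫ Y.Γevaluation (f.base x)).hom.toAlgebra
  have halgY : Spec.map (CommRingCat.ofHom (algebraMap K (Y.residueField (f.base x)))) =
      Y.fromSpecResidueField (f.base x) ≫ p := by
    change Spec.map (CommRingCat.ofHom ((Scheme.ΓSpecIso (CommRingCat.of K)).inv ≫ p.appTop ≫
      Y.Γevaluation (f.base x)).hom) = _
    rw [CommRingCat.ofHom_hom]
    exact Scheme.SpecMap_ΓSpecIso_inv_appTop_Γevaluation p (f.base x)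
  letI algXY : Algebra (Y.residueField (f.base x)) (X.residueField x) :=
    (f.residueFieldMap x).hom.toAlgebra
  letI algX : Algebra K (X.residueField x) :=
    ((f.residueFieldMap x).hom.comp (algebraMap K (Y.residueField (f.base x)))).toAlgebra
  haveI : IsScalarTower K (Y.residueField (f.base x)) (X.residueField x) :=
    IsScalarTower.of_algebraMap_eq fun _ ↦ rfl
  have halgX : Spec.map (CommRingCat.ofHom (algebraMap K (X.residueField x))) =
      X.fromSpecResidueField x ≫ f ≫ p := by
    change Spec.map (CommRingCat.ofHom ((f.residueFieldMap x).hom.comp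
      (algebraMap K (Y.residueField (f.base x))))) = _
    rw [show CommRingCat.ofHom ((f.residueFieldMap x).hom.comp
        (algebraMap K (Y.residueField (f.base x)))) =
        CommRingCat.ofHom (algebraMap K (Y.residueField (f.base x))) ≫ f.residueFieldMap x from rfl,
      Spec.map_comp, halgY, ← Category.assoc,
      Scheme.Hom.SpecMap_residueFieldMap_fromSpecResidueField, Category.assoc]
  have h1 := Scheme.height_eq_toENat_trdeg_residueField (f ≫ p) x halgX
  have h2 := Scheme.height_eq_toENat_trdeg_residueField p (f.base x) halgY
  -- `κ(f x) →ₐ[K] κ(x)` is injective, so `trdeg_K κ(f x) ≤ trdeg_K κ(x)`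
  have h3 : Algebra.trdeg K (Y.residueField (f.base x)) ≤ Algebra.trdeg K (X.residueField x) :=
    trdeg_le_of_injective
      (IsScalarTower.toAlgHom K (Y.residueField (f.base x)) (X.residueField x))
      (algebraMap (Y.residueField (f.base x)) (X.residueField x)).injective
  rw [h1, h2]
  exact OrderHomClass.mono Cardinal.toENat h3

/-- The case of `K`-schemes in `Over (Spec K)`: for a morphism `φ : V ⟶ W` of `K`-schemes locally of
finite type over `K`, `Order.height (φ v) ≤ Order.height v`. [cite: GortzWedhorn2020, Thm. 5.22 (1)] -/
theorem height_base_le_height_of_schemeOver {V W : SchemeOver K} [LocallyOfFiniteType V.hom]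
    [LocallyOfFiniteType W.hom] (φ : V ⟶ W) (v : V.left) :
    height (φ.left.base v) ≤ height v := by
  haveI : LocallyOfFiniteType (φ.left ≫ W.hom) := by
    rw [Over.w φ]
    infer_instance
  exact height_base_le_height φ.left W.hom v

end Height

end Literature.AlgebraicGeometry.Motives

end
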